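import Literature.MathematicalPhysics.QuantumFieldTheory.Balaban1983to89.B9Thm313WholeDirZ
import Literature.MathematicalPhysics.QuantumFieldTheory.Balaban1983to89.B9Thm313WholeHolderZ
import Literature.MathematicalPhysics.QuantumFieldTheory.Balaban1983to89.B9Thm312WholeHZ

/-!
# `Balaban1983to89.B9LettersZSchemasMono` — [B9] Thm 3.12 ∕ 3.13 (pp. 420–426), bookkeeping: CONSTANT- AND RATE-MONOTONICITY of the six
# sup ∕ probe-class letter schemas of rows 20–21 over the weighted averaging class `Z_{wZ}` (`LettersHZ`, `LettersHHZ`, `Letters313Z`,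
# `Letters313DZ`, `Letters313DMZ`, `Letters313HZ`) — each schema at constants `C` and rate `δ` implies the same schema at any `C′ ≥ C`, `δ′ ≤ δ`

T. Bałaban, *Propagators for lattice gauge theories in a background field*, Commun. Math. Phys. **99** (1985) 389–434
[`Balaban1985BackgroundPropagators`, "B9"]; [4] = T. Bałaban, *Propagators and renormalization transformations for lattice gauge
theories. II*, Commun. Math. Phys. **96** (1984) 223–250 [`Balaban1984PropagatorsII`].

statement-level skeleton of published theorems with citation tags; proofs where landed; nothing here is a claim about the Yang–Mills
mass gap

THE POINT (cell `pub-ymgap`, node N06 [B9]; width seat w5).  The N06 stage-11 certificate (dag-n06-d, editions ≥ 22) displays the rows-20–21 letter schemas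
`hlettersH12 : LettersHZ … B12₃ δ12₃ U`, `hLHH : LettersHHZ … Bq12 δ12₃ U`, `hletters13 : Letters313Z … B12₃ δ12₃ U`, `hlettersD13 : Letters313DZ … ∧ Letters313DMZ … B12₃ Bq12 δ12₃ …`,
`hLH3 : Letters313HZ … BhD13 Bx13 δ12₃ U` with SHARED constants; when one of them becomes a THEOREM of the pins at its own closed letter (e.g. `hLHH` at
`Bq β := Bh12 β·e^{δ_Q(ℓ+4)}·c` by `B9LettersHHZWholeAtPins.lettersHHZ_pins`, dag-n06-d g11 LOCATED-ED36 (c)), the knit needs the OTHER schemas weakened to the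
common letter `max(displayed, derived)`.  The tree has the RATE monotonicity of the two block-L² Z-schemas (`letters313L2PZ_mono`, `letters313L2MZ_mono`) and
nothing for the sup∕probe schemas.  THIS FILE: for each of the six schemas, the weakening «constants up, rate down» (`B₃ ≤ B₃′`, `Bq β ≤ Bq′ β` on `0 ≤ β < 1`,
`BhD ∕ Bx` likewise, `δ′ ≤ δ`, the smaller constants nonnegative), fieldwise by `HasMaj.mono` and `e^{−δd} ≤ e^{−δ′d}` (`d ≥ 0`):
`lettersHZ_mono`, `lettersHHZ_mono`, `letters313Z_mono`, `letters313DZ_mono`, ★ `letters313DMZ_mono`, `letters313HZ_mono`.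
KNIT (dag-n06-d, ED.36 route (c1)): `Bq⋆ β := max (Bq12 β) (Bh12 β·e^{δ_Q(ℓ+4)}·cσ)`; `hLHH` derived at `Bq⋆` (`lettersHHZ_pins … (hBq := fun β _ _ => le_max_right _ _)`),
`(hlettersD13 …).2` weakened to `Bq⋆` by `letters313DMZ_mono hG hB12₃ le_rfl hBq12 (fun β _ _ => le_max_left _ _) le_rfl`.

HONEST SCOPE.  Pure bookkeeping on hypothesis schemas (generic `Ops g B X Y Z W`; no pins, no analysis); nothing of [B9] asserted; COUNT-NEUTRAL; N06 is NOT discharged;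
nothing continuum, nothing about the mass gap ∕ Clay.  Cell `pub-ymgap` (HUMAN RULING D-0062 ∕ D-0154), Track A node N06 [B9], width seat `pub-ymgap-dag-n06-w5` (g2), 2026-08-28.
-/

noncomputable section

namespace Literature.MathematicalPhysics.QuantumFieldTheory.Balaban1983to89.B9LettersZSchemasMono

open B9Thm34Ext (toB6)
open B11SectG (HasMaj BlockNorm)
open B9Thm312Whole (Ops GeoOK)
open B9RWSums343Holder (HolderProbes)
open B9Thm312WholeHZ (LettersHZ LettersHHZ)
open B9Thm313WholeZ (Letters313Z)
open B9Thm313WholeLeftZ (Letters313DZ)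
open B9Thm313WholeDirZ (Letters313DMZ)
open B9Thm313WholeHolderZ (Letters313HZ)

variable {g : B9.Geometry} {B : B9.Backgrounds} {X Y Z W PX PY P : Type} {R₀ : ℝ} {H₀ : Prop}

/-- the kernel weakening `C·e^{−δd} ≤ C′·e^{−δ′d}` for `0 ≤ C ≤ C′`, `δ′ ≤ δ`, `d ≥ 0`. [cite: Balaban1984PropagatorsII, (2.51)–(2.54) p.232 (bookkeeping)] -/
theorem kernel_mono (hG : GeoOK g) {C C' δ δ' : ℝ} (hC : 0 ≤ C) (hCC : C ≤ C') (hδ : δ' ≤ δ) (a b : g.Site) :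
    C * Real.exp (-(δ * g.dist a b)) ≤ C' * Real.exp (-(δ' * g.dist a b)) :=
  mul_le_mul hCC (Real.exp_le_exp.mpr (neg_le_neg (mul_le_mul_of_nonneg_right hδ (hG.dnn a b)))) (Real.exp_nonneg _) (hC.trans hCC)

/-- `LettersHZ` at weaker letters: `B₃ ≤ B₃′`, `δ′ ≤ δ`. [cite: Balaban1985BackgroundPropagators, (3.126) p.420 + (3.132) p.422 (bookkeeping)] -/
theorem lettersHZ_mono [Fintype X] [Fintype Y] [Fintype Z] [Fintype g.Site] {𝔬 : Ops g B X Y Z W} (hG : GeoOK g)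
    {bZ : BlockNorm (toB6 g R₀ H₀) (Z → ℝ)} {B₃ B₃' δ δ' : ℝ} {U : B.Cfg}
    (hB : 0 ≤ B₃) (hBB : B₃ ≤ B₃') (hδ : δ' ≤ δ) (h : LettersHZ 𝔬 R₀ H₀ hG bZ B₃ δ U) : LettersHZ 𝔬 R₀ H₀ hG bZ B₃' δ' U where
  gQs2 := h.gQs2.mono (kernel_mono hG hB hBB hδ)
  dgQs := h.dgQs.mono (kernel_mono hG hB hBB hδ)
  c2 := h.c2.mono (kernel_mono hG hB hBB hδ)
  c12 := h.c12.mono (kernel_mono hG hB hBB hδ)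

/-- `LettersHHZ` at weaker letters: `Bq β ≤ Bq′ β` on `0 ≤ β < 1`, `δ′ ≤ δ`. [cite: Balaban1985BackgroundPropagators, (3.133) p.422 + (3.43) p.398 (bookkeeping)] -/
theorem lettersHHZ_mono [Fintype X] [Fintype Y] [Fintype Z] [Fintype PY] [Fintype g.Site] {𝔬 : Ops g B X Y Z W}
    {𝔭 : HolderProbes g B X Y PX PY} (hG : GeoOK g) {hlen : ∀ y : g.Site, 0 ≤ g.len y}
    {bZ : BlockNorm (toB6 g R₀ H₀) (Z → ℝ)} {Bq Bq' : ℝ → ℝ} {δ δ' : ℝ} {U : B.Cfg}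
    (hB : ∀ β, 0 ≤ β → β < 1 → 0 ≤ Bq β) (hBB : ∀ β, 0 ≤ β → β < 1 → Bq β ≤ Bq' β) (hδ : δ' ≤ δ)
    (h : LettersHHZ 𝔬 𝔭 R₀ H₀ hlen bZ Bq δ U) : LettersHHZ 𝔬 𝔭 R₀ H₀ hlen bZ Bq' δ' U where
  pQ β hβ hβ1 := (h.pQ β hβ hβ1).mono (kernel_mono hG (hB β hβ hβ1) (hBB β hβ hβ1) hδ)

/-- `Letters313Z` at weaker letters: `B₃ ≤ B₃′`, `δ′ ≤ δ`. [cite: Balaban1985BackgroundPropagators, Thm 3.13 p.426 + (3.42) p.397 + (3.132) p.422 (bookkeeping)] -/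
theorem letters313Z_mono [Fintype X] [Fintype Y] [Fintype Z] [Fintype W] [Fintype g.Site] {𝔬 : Ops g B X Y Z W} (hG : GeoOK g)
    {wZ : g.Site → ℝ} {hwZ : ∀ y, 0 < wZ y} {B₃ B₃' δ δ' : ℝ} {U : B.Cfg}
    (hB : 0 ≤ B₃) (hBB : B₃ ≤ B₃') (hδ : δ' ≤ δ) (h : Letters313Z 𝔬 R₀ H₀ hG wZ hwZ B₃ δ U) : Letters313Z 𝔬 R₀ H₀ hG wZ hwZ B₃' δ' U where
  gD1 := h.gD1.mono (kernel_mono hG hB hBB hδ)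
  gD2 := h.gD2.mono (kernel_mono hG hB hBB hδ)
  gQs2 := h.gQs2.mono (kernel_mono hG hB hBB hδ)
  gQs1 := h.gQs1.mono (kernel_mono hG hB hBB hδ)
  rgd2 := h.rgd2.mono (kernel_mono hG hB hBB hδ)
  rgd1 := h.rgd1.mono (kernel_mono hG hB hBB hδ)
  c1_2 := h.c1_2.mono (kernel_mono hG hB hBB hδ)
  c1_1 := h.c1_1.mono (kernel_mono hG hB hBB hδ)
  q2 := h.q2.mono (kernel_mono hG hB hBB hδ)
  q1 := h.q1.mono (kernel_mono hG hB hBB hδ)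

/-- `Letters313DZ` at weaker letters: `B₃ ≤ B₃′`, `δ′ ≤ δ` (the W-Hölder source class `bH` unchanged). [cite: Balaban1985BackgroundPropagators, Thm 3.13 p.426 + (3.42)–(3.44) pp.397–398 (bookkeeping)] -/
theorem letters313DZ_mono [Fintype X] [Fintype Y] [Fintype Z] [Fintype W] [Fintype g.Site] {𝔬 : Ops g B X Y Z W} (hG : GeoOK g)
    {wZ : g.Site → ℝ} {hwZ : ∀ y, 0 < wZ y} {B₃ B₃' δ δ' : ℝ} {bH : BlockNorm (toB6 g R₀ H₀) (W → ℝ)} {U : B.Cfg}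
    (hB : 0 ≤ B₃) (hBB : B₃ ≤ B₃') (hδ : δ' ≤ δ) (h : Letters313DZ 𝔬 R₀ H₀ hG wZ hwZ B₃ δ bH U) :
    Letters313DZ 𝔬 R₀ H₀ hG wZ hwZ B₃' δ' bH U where
  dgQs := h.dgQs.mono (kernel_mono hG hB hBB hδ)
  rgdH := h.rgdH.mono (kernel_mono hG hB hBB hδ)
  dgDH := h.dgDH.mono (kernel_mono hG hB hBB hδ)

/-- ★ `Letters313DMZ` at weaker letters: `B₃ ≤ B₃′`, `Bq β ≤ Bq′ β` on `0 ≤ β < 1`, `δ′ ≤ δ` (the W-Hölder source class `bH` unchanged) — the lemma of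
dag-n06-d's ED.36 route (c1): the displayed `(hlettersD13 …).2` at `Bq12` weakened to `max (Bq12 β) (Bh12 β·e^{δ_Q(ℓ+4)}·c)`, the letter at which `hLHH` is derived.
[cite: Balaban1985BackgroundPropagators, Thm 3.13 p.426 + (3.126) p.420 + (3.42)–(3.44) pp.397–398 + (3.43) p.398 (bookkeeping)] -/
theorem letters313DMZ_mono [Fintype X] [Fintype Y] [Fintype Z] [Fintype W] [Fintype PX] [Fintype g.Site] {𝔬 : Ops g B X Y Z W}
    {𝔭 : HolderProbes g B X Y PX PY} {Dd : B.Cfg → P → Module.End ℝ (X → ℝ)} (hG : GeoOK g)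
    {wZ : g.Site → ℝ} {hwZ : ∀ y, 0 < wZ y} {B₃ B₃' : ℝ} {Bq Bq' : ℝ → ℝ} {δ δ' : ℝ} {bH : BlockNorm (toB6 g R₀ H₀) (W → ℝ)} {U : B.Cfg}
    (hB : 0 ≤ B₃) (hBB : B₃ ≤ B₃') (hBq : ∀ β, 0 ≤ β → β < 1 → 0 ≤ Bq β) (hBqq : ∀ β, 0 ≤ β → β < 1 → Bq β ≤ Bq' β) (hδ : δ' ≤ δ)
    (h : Letters313DMZ 𝔬 𝔭 Dd R₀ H₀ hG wZ hwZ B₃ Bq δ bH U) : Letters313DMZ 𝔬 𝔭 Dd R₀ H₀ hG wZ hwZ B₃' Bq' δ' bH U where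
  dgQsd ν := (h.dgQsd ν).mono (kernel_mono hG hB hBB hδ)
  dgDHd ν := (h.dgDHd ν).mono (kernel_mono hG hB hBB hδ)
  pQd ν β hβ hβ1 := (h.pQd ν β hβ hβ1).mono (kernel_mono hG (hBq β hβ hβ1) (hBqq β hβ hβ1) hδ)

/-- `Letters313HZ` at weaker letters: `BhD β ≤ BhD′ β`, `Bx β ≤ Bx′ β` on `0 ≤ β < 1`, `δ′ ≤ δ` (source class `bW` unchanged).
[cite: Balaban1985BackgroundPropagators, Thm 3.13 p.426 + (3.43)–(3.45) p.398 (bookkeeping)] -/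
theorem letters313HZ_mono [Fintype X] [Fintype Z] [Fintype W] [Fintype PX] [Fintype PY] [Fintype g.Site] {𝔬 : Ops g B X Y Z W}
    {𝔭 : HolderProbes g B X Y PX PY} (hG : GeoOK g) {wZ : g.Site → ℝ} {hwZ : ∀ y, 0 < wZ y} {bW : BlockNorm (toB6 g R₀ H₀) (W → ℝ)}
    {BhD BhD' Bx Bx' : ℝ → ℝ} {δ δ' : ℝ} {U : B.Cfg}
    (hBh : ∀ β, 0 ≤ β → β < 1 → 0 ≤ BhD β) (hBhh : ∀ β, 0 ≤ β → β < 1 → BhD β ≤ BhD' β)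
    (hBx : ∀ β, 0 ≤ β → β < 1 → 0 ≤ Bx β) (hBxx : ∀ β, 0 ≤ β → β < 1 → Bx β ≤ Bx' β) (hδ : δ' ≤ δ)
    (h : Letters313HZ 𝔬 𝔭 R₀ H₀ hG wZ hwZ bW BhD Bx δ U) : Letters313HZ 𝔬 𝔭 R₀ H₀ hG wZ hwZ bW BhD' Bx' δ' U where
  pYDH β hβ hβ1 := (h.pYDH β hβ hβ1).mono (kernel_mono hG (hBh β hβ hβ1) (hBhh β hβ hβ1) hδ)
  pXDv β hβ hβ1 := (h.pXDv β hβ hβ1).mono (kernel_mono hG (hBx β hβ hβ1) (hBxx β hβ hβ1) hδ)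
  pXQs β hβ hβ1 := (h.pXQs β hβ hβ1).mono (kernel_mono hG (hBx β hβ hβ1) (hBxx β hβ hβ1) hδ)

end Literature.MathematicalPhysics.QuantumFieldTheory.Balaban1983to89.B9LettersZSchemasMono

end
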